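import Summits.CriticalPhenomena.CardyFormulaZ2.Theorems.CardyComplexConeParafermionToSLESixFamiliesDiamondDefs
import Literature.Analysis.Complex.SchwarzReflection
import Mathlib.Analysis.Analytic.IsolatedZeros
import HarnessLib

/-!
# Line `potential-darboux-picard-diamond`, stub S4 (`stub_identifyPotential`): the reflected map of a half-disc into `ℍ` has non-vanishing derivative at the centre

Helper file of the stub `stub_identifyPotential` of crux `ParafermionToSLESixFamilies` (stmt-CriticalPhenomena-11389).
Step (v) of the identification (`(G′)³ = c·ψ′/ψ` via the bounded holomorphic function `H = (G′)³ψ/ψ′` of constant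
argument on the boundary) needs the LOCAL EXPONENTS of the conformal maps `G` (onto the limit hexagon) and `ψ = φ⁻¹` (onto
`ℍ`) at the corners and marks of the diamond. After straightening the corner by an integer power on the domain side and a
fractional power on the image side, each of them becomes a map `F` of a half-disc into the closed upper half-plane,
continuous up to the diameter, real there, with `F(0) = 0`; the exponent count is then the statement of this file
(`deriv_schwarzReflection_ne_zero_of_im_pos`, registered helper of the crux item): the Schwarz reflection of such an `F`
(holomorphic on the whole disc by the tree's reflection principle `Complex.differentiableOn_schwarzReflection`) has
NON-ZERO DERIVATIVE at `0`. Proof: by the isolated-zeros factorisation `F̂ = zⁿ g`, `g(0) ≠ 0`; if `n ≥ 2` the rays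
`arg z = t` and `arg z = t + π/n` both lie in the upper half-disc and carry opposite signs of `im (e^{int} g(0))`, so `F`
would take values in the lower half-plane near `0` — contradicting `im F > 0` on the upper half-disc.
-/

noncomputable section

namespace Summit.CriticalPhenomena.CardyFormulaZ2.Cruxes.ParafermionToSLESixFamilies.PotentialDarbouxPicardDiamond

open scoped Topology Real ComplexConjugate
open Filter Set Metric Complex

/-- Sign alternation: `im (e^{i n (t + π/n)} a) = − im (e^{i n t} a)`. -/
theorem im_exp_mul_shift (n : ℕ) (hn : n ≠ 0) (t : ℝ) (a : ℂ) :
    (exp ((n : ℂ) * ((t + π / n : ℝ) : ℂ) * I) * a).im = -(exp ((n : ℂ) * (t : ℂ) * I) * a).im := by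
  have : (n : ℂ) * ((t + π / n : ℝ) : ℂ) * I = (n : ℂ) * (t : ℂ) * I + π * I := by
    have hn' : (n : ℂ) ≠ 0 := by exact_mod_cast hn
    push_cast
    field_simp
  rw [this, Complex.exp_add, exp_pi_mul_I]
  simp

/-- For `a ≠ 0` and `n ≥ 1`, the two test angles `π/(4n)` and `π/(2n)` cannot both kill `im (e^{int} a)`. -/
theorem im_exp_mul_ne_zero_or (n : ℕ) (hn : n ≠ 0) {a : ℂ} (ha : a ≠ 0) :
    (exp ((n : ℂ) * ((π / (4 * n) : ℝ) : ℂ) * I) * a).im ≠ 0 ∨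
      (exp ((n : ℂ) * ((π / (2 * n) : ℝ) : ℂ) * I) * a).im ≠ 0 := by
  have hn' : (n : ℂ) ≠ 0 := by exact_mod_cast hn
  have h1 : (n : ℂ) * ((π / (4 * n) : ℝ) : ℂ) * I = ((π / 4 : ℝ) : ℂ) * I := by
    push_cast; field_simp
  have h2 : (n : ℂ) * ((π / (2 * n) : ℝ) : ℂ) * I = ((π / 2 : ℝ) : ℂ) * I := by
    push_cast; field_simp
  have hquarter : exp (((π / 4 : ℝ) : ℂ) * I) = ((Real.sqrt 2 / 2 : ℝ) : ℂ) + ((Real.sqrt 2 / 2 : ℝ) : ℂ) * I := by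
    rw [exp_mul_I, ← ofReal_cos, ← ofReal_sin, Real.cos_pi_div_four, Real.sin_pi_div_four]
  have hhalf : exp (((π / 2 : ℝ) : ℂ) * I) = I := by
    rw [exp_mul_I, ← ofReal_cos, ← ofReal_sin, Real.cos_pi_div_two, Real.sin_pi_div_two]
    simp
  rw [h1, h2, hquarter, hhalf]
  by_contra hcon
  push Not at hcon
  obtain ⟨e1, e2⟩ := hcon
  have hre : a.re = 0 := by simpa using e2
  have him : a.im = 0 := by
    simp only [mul_im, add_re, add_im, ofReal_re, ofReal_im, mul_re, I_re, I_im, mul_zero, mul_one,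
      sub_zero, zero_add, add_zero, hre] at e1
    have hs : Real.sqrt 2 / 2 ≠ 0 := by positivity
    exact (mul_eq_zero.1 e1).resolve_left hs
  exact ha (Complex.ext hre him)

/-- **The Schwarz reflection of a map of the upper half-disc into `ℍ`, real on the diameter and vanishing at the centre,
has non-zero derivative at the centre.** Let `f` be continuous on `ball 0 r ∩ {im ≥ 0}`, holomorphic on
`ball 0 r ∩ {im > 0}`, real on the diameter, with `f 0 = 0` and `im f > 0` on the open upper half-disc. Then the Schwarz
reflection of `f` is holomorphic on `ball 0 r` (reflection principle of the tree) and its derivative at `0` does not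
vanish: in the isolated-zeros factorisation `F̂ = zⁿ g`, `g(0) ≠ 0`, an exponent `n ≥ 2` would let the upper half-disc
reach the lower half-plane. -/
theorem deriv_schwarzReflection_ne_zero_of_im_pos : ∀ (f : ℂ → ℂ) (r : ℝ), 0 < r → ContinuousOn f (Metric.ball (0:ℂ) r ∩ {z : ℂ | 0 ≤ z.im}) → DifferentiableOn ℂ f (Metric.ball (0:ℂ) r ∩ {z : ℂ | 0 < z.im}) → (∀ z ∈ Metric.ball (0:ℂ) r, z.im = 0 → (starRingEnd ℂ) (f z) = f z) → f 0 = 0 → (∀ z ∈ Metric.ball (0:ℂ) r, 0 < z.im → 0 < (f z).im) → DifferentiableOn ℂ (Complex.schwarzReflection f) (Metric.ball (0:ℂ) r) ∧ deriv (Complex.schwarzReflection f) 0 ≠ 0 := by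
  intro f r hr hc hd hreal h0 hpos
  set F := schwarzReflection f with hF
  have hsymm : ∀ z ∈ ball (0:ℂ) r, conj z ∈ ball (0:ℂ) r := fun z hz => by
    rw [mem_ball_zero_iff] at hz ⊢
    rwa [norm_conj]
  have hFd : DifferentiableOn ℂ F (ball 0 r) := differentiableOn_schwarzReflection isOpen_ball hsymm hc hd hreal
  refine ⟨hFd, ?_⟩
  have hF0 : F 0 = 0 := by
    simp only [hF]
    rw [schwarzReflection_of_nonneg (by simp), h0]
  have hFan : AnalyticAt ℂ F 0 := hFd.analyticAt (ball_mem_nhds 0 hr)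
  -- `F` is not identically zero near `0`
  have hFne : ¬∀ᶠ z in 𝓝 (0:ℂ), F z = 0 := by
    intro hev
    obtain ⟨ε, hε, hball⟩ := Metric.eventually_nhds_iff_ball.1 hev
    set z : ℂ := ((min ε r / 2 : ℝ) : ℂ) * I with hz
    have hmin : 0 < min ε r := lt_min hε hr
    have hzim : 0 < z.im := by simp [hz, hmin]
    have hnorm : ‖z‖ = min ε r / 2 := by
      rw [hz, norm_mul, norm_real, norm_I, mul_one, Real.norm_eq_abs, abs_of_pos (by positivity)]
    have hzε : z ∈ ball (0:ℂ) ε := by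
      rw [mem_ball_zero_iff, hnorm]; linarith [min_le_left ε r]
    have hzr : z ∈ ball (0:ℂ) r := by
      rw [mem_ball_zero_iff, hnorm]; linarith [min_le_right ε r]
    have h1 : F z = 0 := hball z hzε
    have h2 : F z = f z := schwarzReflection_of_nonneg hzim.le
    have h3 := hpos z hzr hzim
    rw [← h2, h1, zero_im] at h3
    exact lt_irrefl _ h3
  obtain ⟨n, g, hg, hg0, hfg⟩ := hFan.exists_eventuallyEq_pow_smul_nonzero_iff.2 hFne
  have hn0 : n ≠ 0 := by
    rintro rfl
    have h1 := hfg.self_of_nhds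
    rw [pow_zero, one_smul, hF0] at h1
    exact hg0 h1.symm
  rcases Nat.lt_or_ge n 2 with hlt | hge
  · -- simple zero: `deriv F 0 = g 0 ≠ 0`
    have hn1 : n = 1 := by omega
    subst hn1
    have hev : F =ᶠ[𝓝 0] fun z => z * g z := by
      filter_upwards [hfg] with z hz
      rw [hz, sub_zero, pow_one, smul_eq_mul]
    rw [hev.deriv_eq]
    have hder : HasDerivAt (fun z : ℂ => z * g z) (1 * g 0 + (0:ℂ) * deriv g 0) 0 :=
      (hasDerivAt_id' (0:ℂ)).mul hg.differentiableAt.hasDerivAt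
    rw [hder.deriv]
    simpa using hg0
  · -- multiple zero: the upper half-disc would reach the lower half-plane
    exfalso
    have hnpos : (0:ℝ) < n := by exact_mod_cast Nat.pos_of_ne_zero hn0
    have hn2 : (2:ℝ) ≤ n := by exact_mod_cast hge
    have hπn : π / n ≤ π / 2 := div_le_div_of_nonneg_left Real.pi_pos.le two_pos hn2
    -- a test angle with non-vanishing sign, leaving room for the shift by `π/n`
    obtain ⟨t₀, ht₀pos, ht₀lt, ht₀ne⟩ : ∃ t₀ : ℝ, 0 < t₀ ∧ t₀ + π / n < π ∧
        (exp ((n : ℂ) * (t₀ : ℂ) * I) * g 0).im ≠ 0 := by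
      rcases im_exp_mul_ne_zero_or n hn0 hg0 with h | h
      · refine ⟨π / (4 * n), by positivity, ?_, h⟩
        have : π / (4 * n) ≤ π / 8 := div_le_div_of_nonneg_left Real.pi_pos.le (by norm_num) (by nlinarith)
        linarith [Real.pi_pos]
      · refine ⟨π / (2 * n), by positivity, ?_, h⟩
        have : π / (2 * n) ≤ π / 4 := div_le_div_of_nonneg_left Real.pi_pos.le (by norm_num) (by nlinarith)
        linarith [Real.pi_pos]
    obtain ⟨t, htpos, htlt, hneg⟩ : ∃ t : ℝ, 0 < t ∧ t < π ∧ (exp ((n : ℂ) * (t : ℂ) * I) * g 0).im < 0 := by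
      rcases lt_or_gt_of_ne ht₀ne with h | h
      · exact ⟨t₀, ht₀pos, by linarith [div_pos Real.pi_pos hnpos], h⟩
      · refine ⟨t₀ + π / n, by positivity, ht₀lt, ?_⟩
        rw [im_exp_mul_shift n hn0]
        linarith
    -- the ray `ρ ↦ ρ e^{it}`, `ρ → 0⁺`
    set ray : ℝ → ℂ := fun ρ => (ρ : ℂ) * exp ((t : ℂ) * I) with hray
    have hrayc : Continuous ray := continuous_ofReal.mul continuous_const
    have hray0 : Tendsto ray (𝓝[>] 0) (𝓝 0) := by
      have h1 : Tendsto ray (𝓝 0) (𝓝 (ray 0)) := hrayc.tendsto 0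
      have h2 : ray 0 = 0 := by simp [hray]
      rw [h2] at h1
      exact h1.mono_left nhdsWithin_le_nhds
    have hray_im : ∀ ρ : ℝ, (ray ρ).im = ρ * Real.sin t := fun ρ => by
      simp only [hray, im_ofReal_mul, exp_ofReal_mul_I_im]
    have hsin : 0 < Real.sin t := Real.sin_pos_of_pos_of_lt_pi htpos htlt
    have hev1 : ∀ᶠ ρ in 𝓝[>] (0:ℝ), ray ρ ∈ ball (0:ℂ) r := hray0.eventually (ball_mem_nhds 0 hr)
    have hev2 : ∀ᶠ ρ in 𝓝[>] (0:ℝ), F (ray ρ) = (ray ρ) ^ n * g (ray ρ) := by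
      filter_upwards [hray0.eventually hfg] with ρ hρ
      rw [hρ, sub_zero, smul_eq_mul]
    have hev3 : ∀ᶠ ρ in 𝓝[>] (0:ℝ), (exp ((n : ℂ) * (t : ℂ) * I) * g (ray ρ)).im < 0 := by
      have hgc : ContinuousAt g 0 := hg.continuousAt
      have hT : Tendsto (fun ρ => (exp ((n : ℂ) * (t : ℂ) * I) * g (ray ρ)).im) (𝓝[>] 0)
          (𝓝 ((exp ((n : ℂ) * (t : ℂ) * I) * g 0).im)) :=
        (continuous_im.tendsto _).comp (tendsto_const_nhds.mul (hgc.tendsto.comp hray0))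
      exact hT.eventually (Iio_mem_nhds hneg)
    have hev4 : ∀ᶠ ρ in 𝓝[>] (0:ℝ), 0 < ρ := eventually_mem_nhdsWithin
    obtain ⟨ρ, h1, h2, h3, h4⟩ := (hev1.and (hev2.and (hev3.and hev4))).exists
    have hρim : 0 < (ray ρ).im := by rw [hray_im]; exact mul_pos h4 hsin
    have hFf : F (ray ρ) = f (ray ρ) := schwarzReflection_of_nonneg hρim.le
    have hposρ := hpos (ray ρ) h1 hρim
    have hexpn : exp ((n : ℂ) * (t : ℂ) * I) = exp ((t : ℂ) * I) ^ n := by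
      rw [← Complex.exp_nat_mul]; ring_nf
    have hpow : (ray ρ) ^ n = ((ρ ^ n : ℝ) : ℂ) * exp ((n : ℂ) * (t : ℂ) * I) := by
      simp only [hray]; rw [mul_pow, hexpn, ofReal_pow]
    have him : (F (ray ρ)).im = ρ ^ n * (exp ((n : ℂ) * (t : ℂ) * I) * g (ray ρ)).im := by
      rw [h2, hpow, mul_assoc, im_ofReal_mul]
    have hlt0 : (F (ray ρ)).im < 0 := by rw [him]; exact mul_neg_of_pos_of_neg (pow_pos h4 n) h3
    rw [hFf] at hlt0
    linarith

end Summit.CriticalPhenomena.CardyFormulaZ2.Cruxes.ParafermionToSLESixFamilies.PotentialDarbouxPicardDiamond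

end
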